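import Summits.FinalStateConjecture.FinalStateConjecture.Theorems.BartnikGapSettlingBondiBartnikRigidityFarCompletionAssembly
import HarnessLib

/-!
# Far completion (stub K4 `stub_farCompletion`, line `direct-method-on-the-cone`, crux
# `BondiBartnikRigidity`, stmt-FinalStateConjecture-10807): recentring identities, translation
# covariance of boxes, and the REDUCTION of the registered stub to its typed inputs

* RECENTRING IDENTITIES — `poincareInv_recentre`, `translateBackground_starBackground`,
  `shiftTime_starBackground`, `shiftTime_translateBackground_starBackground`: translating the
  coordinates of the boosted Kerr star background by `w` and shifting its Kerr-star time by `s` gives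
  EXACTLY the star background of the recentred motion `recentre (Λ, c) s w = (Λ, c − w + Λ(s e₀))`
  (Kerr–Schild stationarity, `t*`-invariance of the star region and radius);
* TRANSLATION COVARIANCE OF BOXES — `IsNearModelBox.comp_translateMap`: the translated chart
  `Ψ ∘ T_w` is an `(ε, k)`-box of the translated background with the same parameters inside the same
  set (on the open box the zero-extended deviation of the translated chart is the translate of that of
  `Ψ`, and iterated derivatives are local);
* the REDUCTIONS — `farCompletion_oriented_of_fact : FarHyperboloidalCompletionRest → (K4 with a
  time-oriented box)` and the registered
  `stub_farCompletion_of_facts : FarHyperboloidalCompletionRest → RestCollarBoxOriented → (registered K4)`,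
  by the assembly theorem of `…FarCompletionAssembly.lean`.

STATUS of the inputs (docstrings of `…FarCompletionDefs.lean`): F2ʳ is research-level and unprinted
(Klainerman–Nicolò relative to Kerr + Bondi-flux budget + high-frequency exclusion), size XL; the bridge
`RestCollarBoxOriented` is discharged for free by threading the orientation of K3's box through the
skeleton.  Nothing is asserted about either; the stub `stub_farCompletion` stays open behind them.

References: Kerr–Schild 1965, §2 [KerrSchild1965]; Dafermos–Rodnianski arXiv:0811.0354, §5.1
[DafermosRodnianski2008]; DHRT arXiv:2104.08222, §1 [DafermosHolzegelRodnianskiTaylor2021]; O'Neill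
1983, Ch. 9, p. 236 [ONeillSemiRiemannian1983]; Klainerman–Nicolò 2003, Thm. 1.1 [KlainermanNicolo2003].
-/

noncomputable section

-- D-0017: single-problem summit, `Summit.<S>.<S>.…` by design (cf. lakefile `weak.linter.dupNamespace`).
set_option linter.dupNamespace false
-- instance search through the nested operator types of the Kerr chart facts
set_option maxSynthPendingDepth 3

open Set Filter Function Topology TopologicalSpace
open Literature.Geometry.Lorentzian
open scoped Manifold ContDiff Topology ENNReal

namespace Summit.FinalStateConjecture.FinalStateConjecture.Theorems.BondiBartnikRigidity.DirectMethod

universe u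


/-! ### Recentring identities for the boosted Kerr star background -/

/-- Rest-frame coordinates of the recentred motion: `Λ⁻¹(y − (c − w) − Λ(s e₀)) = Λ⁻¹(y + w − c) − s e₀`.
[folklore] -/
theorem poincareInv_recentre (mo : lorentzGroup × E4) (s : ℝ) (w y : E4) :
    poincareInv (recentre mo s w).1 (recentre mo s w).2 y =
      poincareInv mo.1 mo.2 (y + w) + (-s) • E4.basisVector 0 := by
  show (mo.1 : E4 ≃L[ℝ] E4).symm (y - (mo.2 - w + (mo.1 : E4 ≃L[ℝ] E4) (s • E4.basisVector 0))) =
    (mo.1 : E4 ≃L[ℝ] E4).symm (y + w - mo.2) + (-s) • E4.basisVector 0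
  have h : y - (mo.2 - w + (mo.1 : E4 ≃L[ℝ] E4) (s • E4.basisVector 0)) =
      (y + w - mo.2) - (mo.1 : E4 ≃L[ℝ] E4) (s • E4.basisVector 0) := by abel
  rw [h, map_sub, ContinuousLinearEquiv.symm_apply_apply, neg_smul, sub_eq_add_neg]

/-- Translating the coordinates of the boosted Kerr STAR background by `w` gives the star background
of the translated motion `(Λ, c − w)` (the domain, form, time and radius are all functions of
`Λ⁻¹(x − c)`). [folklore] -/
theorem translateBackground_starBackground (Λ : lorentzGroup) (c : E4) (M a : ℝ) (w : E4) :
    translateBackground (starBackground Λ c M a fun x => Kerr.radius a (poincareInv Λ c x)) w =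
      starBackground Λ (c - w) M a fun x => Kerr.radius a (poincareInv Λ (c - w) x) := by
  have key : ∀ y : E4, poincareInv Λ (c - w) y = poincareInv Λ c (y + w) := fun y => by
    simp only [poincareInv]
    congr 1
    abel
  unfold translateBackground starBackground
  congr 1
  · apply TopologicalSpace.Opens.ext
    ext y
    simp only [TopologicalSpace.Opens.coe_mk, Set.mem_preimage, key]
  · funext y
    ext v v'
    rw [boostedKerrBilin_apply, boostedKerrBilin_apply, key]
  · funext y
    rw [key]
  · funext y
    rw [key]

/-- **Recentring lemma (time).** Shifting the Kerr-star time of the boosted Kerr STAR background by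
`s` gives exactly the star background of the motion translated by `s` units of its rest-frame time:
the star region and the Kerr–Schild radius are `t*`-translation invariant
(`Kerr.radius_add_time_smul_basisVector`) and the Kerr–Schild form is stationary
(`Kerr.bilin_add_smul_basisVector_zero`). Kerr–Schild 1965, §2; DR arXiv:0811.0354, §5.1.
[cite: KerrSchild1965, §2] -/
theorem shiftTime_starBackground (Λ : lorentzGroup) (c : E4) (M a s : ℝ) :
    shiftTime (starBackground Λ c M a fun x => Kerr.radius a (poincareInv Λ c x)) s =
      starBackground Λ (c + (Λ : E4 ≃L[ℝ] E4) (s • E4.basisVector 0)) M a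
        fun x => Kerr.radius a (poincareInv Λ (c + (Λ : E4 ≃L[ℝ] E4) (s • E4.basisVector 0)) x) := by
  have key : ∀ x : E4, poincareInv Λ (c + (Λ : E4 ≃L[ℝ] E4) (s • E4.basisVector 0)) x =
      poincareInv Λ c x + (-s) • E4.basisVector 0 := fun x => by
    have := poincareInv_recentre (Λ, c) s 0 x
    simpa [recentre, sub_zero, add_zero] using this
  have hrad : (fun x => Kerr.radius a (poincareInv Λ (c + (Λ : E4 ≃L[ℝ] E4) (s • E4.basisVector 0)) x)) =
      fun x => Kerr.radius a (poincareInv Λ c x) := by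
    funext x
    rw [key, Kerr.radius_add_time_smul_basisVector]
  unfold shiftTime starBackground
  congr 1
  · apply TopologicalSpace.Opens.ext
    ext x
    simp only [TopologicalSpace.Opens.coe_mk, Set.mem_preimage, SetLike.mem_coe, Kerr.mem_region, key,
      Kerr.radius_add_time_smul_basisVector]
  · funext x
    ext v v'
    rw [boostedKerrBilin_apply, boostedKerrBilin_apply, key, Kerr.bilin_add_smul_basisVector_zero]
  · funext x
    rw [key]
    simp [sub_eq_add_neg]
  · exact hrad.symm


/-- **Recentring lemma (space and time).** Translating the coordinates of the boosted Kerr star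
background by `w` and then shifting its Kerr-star time by `s` gives the star background of the
recentred motion `recentre (Λ, c) s w = (Λ, c − w + Λ(s e₀))`. [cite: KerrSchild1965, §2] -/
theorem shiftTime_translateBackground_starBackground (mo : lorentzGroup × E4) (M a s : ℝ) (w : E4) :
    shiftTime (translateBackground
        (starBackground mo.1 mo.2 M a fun x => Kerr.radius a (poincareInv mo.1 mo.2 x)) w) s =
      starBackground (recentre mo s w).1 (recentre mo s w).2 M a
        fun x => Kerr.radius a (poincareInv (recentre mo s w).1 (recentre mo s w).2 x) := by
  rw [translateBackground_starBackground]
  exact shiftTime_starBackground mo.1 (mo.2 - w) M a s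


/-! ### Translation covariance of `(ε, k)`-boxes -/

section Translate

variable {𝒮 : Spacetime.{u} 4} {B : ModelBackground} {k : ℕ} {ε : ℝ≥0∞} {τ₁ τ₂ r₁ r₂ : ℝ}
  {J : Set 𝒮.carrier} {Ψ : B.domain → 𝒮.carrier} (w : E4)

/-- Domain correspondence (onto) for the translated background: `y ∈ B.domain → y − w` lies in the
translated domain. [folklore] -/
theorem sub_mem_translateBackground_domain {y : E4} (hy : y ∈ (B.domain : Set E4)) :
    y - w ∈ ((translateBackground B w).domain : Set E4) := by
  show y - w + w ∈ (B.domain : Set E4)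
  rwa [sub_add_cancel]

/-- The coordinate box of the translated background is the preimage of the box under the
translation. [folklore] -/
theorem coordBox_translateBackground (B : ModelBackground) (w : E4) (τ₁ τ₂ r₁ r₂ : ℝ) :
    coordBox (translateBackground B w) τ₁ τ₂ r₁ r₂ = translateMap B w ⁻¹' coordBox B τ₁ τ₂ r₁ r₂ :=
  rfl

/-- … and the translation maps it ONTO the box. [folklore] -/
theorem image_translateMap_coordBox (B : ModelBackground) (w : E4) (τ₁ τ₂ r₁ r₂ : ℝ) :
    translateMap B w '' coordBox (translateBackground B w) τ₁ τ₂ r₁ r₂ = coordBox B τ₁ τ₂ r₁ r₂ := by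
  rw [coordBox_translateBackground, translateMap_eq_translate]
  exact (translateBackground B w).image_preimage_translate B w (fun _ h => h)
    (fun _ hy => sub_mem_translateBackground_domain w hy) _

/-- **The differential of the translated chart, locally**: if `Ψ` is differentiable at `y + w` then
`d(Ψ ∘ T_w)_y = dΨ_{y+w}`. [folklore] -/
theorem mfderiv_comp_translateMap_apply (y : (translateBackground B w).domain)
    (hΨ : MDifferentiableAt 𝓘(ℝ, E4) (𝓡 4) Ψ (translateMap B w y)) (v : E4) :
    mfderiv 𝓘(ℝ, E4) (𝓡 4) (Ψ ∘ translateMap B w) y v =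
      mfderiv 𝓘(ℝ, E4) (𝓡 4) Ψ (translateMap B w y) v := by
  have hT : MDifferentiableAt 𝓘(ℝ, E4) 𝓘(ℝ, E4) (translateMap B w) y := by
    rw [translateMap_eq_translate]
    exact ((translateBackground B w).contMDiff_translate B w (fun _ h => h) y).mdifferentiableAt
      (by simp)
  have h := DFunLike.congr_fun (mfderiv_comp y hΨ hT) v
  refine h.trans (congrArg (mfderiv 𝓘(ℝ, E4) (𝓡 4) Ψ (translateMap B w y)) ?_)
  rw [translateMap_eq_translate]
  exact (translateBackground B w).mfderiv_translate_apply B w (fun _ h => h) y v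

/-- **The deviation of the translated chart is the translate of the deviation, locally**: at a point
`y` with `Ψ` differentiable at `y + w`. DHRT arXiv:2104.08222, §1 (the deviation in a fixed gauge).
[cite: DafermosHolzegelRodnianskiTaylor2021, §1] -/
theorem deviation_comp_translateMap (y : (translateBackground B w).domain)
    (hΨ : MDifferentiableAt 𝓘(ℝ, E4) (𝓡 4) Ψ (translateMap B w y)) :
    𝒮.deviation (translateBackground B w) (Ψ ∘ translateMap B w) y =
      𝒮.deviation B Ψ (translateMap B w y) := by
  ext v v'
  rw [Spacetime.deviation_apply, Spacetime.deviation_apply,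
    mfderiv_comp_translateMap_apply w y hΨ v, mfderiv_comp_translateMap_apply w y hΨ v']
  rfl

/-- **TRANSLATION COVARIANCE OF BOXES.** If `Ψ` is an `(ε, k)`-box of a background `B` with
continuous time and radius functions, then the translated chart `Ψ ∘ T_w` is an `(ε, k)`-box of the
translated background with the same parameters, inside the same set: smoothness and the open-embedding
property compose with the (homeomorphic, smooth) translation, the image is unchanged, and on the OPEN
box the zero-extended deviation of the translated chart is the translate of that of `Ψ`, so that its
iterated derivatives — which are local — agree with the translates (`iteratedFDeriv_comp_add_right`).
DHRT arXiv:2104.08222, §1 (closeness in a fixed gauge; translations are gauge-preserving).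
[cite: DafermosHolzegelRodnianskiTaylor2021, §1] -/
theorem IsNearModelBox.comp_translateMap (hBt : Continuous B.time) (hBr : Continuous B.radius)
    (hbox : IsNearModelBox 𝒮 B k ε τ₁ τ₂ r₁ r₂ J Ψ) (w : E4) :
    IsNearModelBox 𝒮 (translateBackground B w) k ε τ₁ τ₂ r₁ r₂ J (Ψ ∘ translateMap B w) := by
  set Bw := translateBackground B w with hBw
  set T := translateMap B w with hT
  have hmem' : ∀ y : E4, y ∈ (B.domain : Set E4) → y - w ∈ (Bw.domain : Set E4) :=
    fun _ hy => sub_mem_translateBackground_domain w hy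
  have hbox_eq : coordBox Bw τ₁ τ₂ r₁ r₂ = T ⁻¹' coordBox B τ₁ τ₂ r₁ r₂ :=
    coordBox_translateBackground B w τ₁ τ₂ r₁ r₂
  have hTc : ContMDiff 𝓘(ℝ, E4) 𝓘(ℝ, E4) ∞ T := by
    rw [hT, translateMap_eq_translate]
    exact Bw.contMDiff_translate B w (fun _ h => h)
  have hTe : IsOpenEmbedding T := by
    rw [hT, translateMap_eq_translate]
    exact Bw.isOpenEmbedding_translate B w (fun _ h => h) hmem'
  -- openness of the box of `B` (in the domain and in `E4`) and of the translated box in `E4`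
  have hopen : IsOpen (coordBox B τ₁ τ₂ r₁ r₂) := isOpen_coordBox hBt hBr τ₁ τ₂ r₁ r₂
  have hBwt : Continuous Bw.time := hBt.comp (continuous_id.add continuous_const)
  have hBwr : Continuous Bw.radius := hBr.comp (continuous_id.add continuous_const)
  have hopenw : IsOpen (Subtype.val '' coordBox Bw τ₁ τ₂ r₁ r₂) :=
    isOpen_image_val_coordBox hBwt hBwr τ₁ τ₂ r₁ r₂
  -- differentiability of `Ψ` at the points of the (open) box
  have hΨd : ∀ y ∈ coordBox Bw τ₁ τ₂ r₁ r₂, MDifferentiableAt 𝓘(ℝ, E4) (𝓡 4) Ψ (T y) := by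
    intro y hy
    rw [hbox_eq] at hy
    exact ((hbox.contMDiffOn (T y) hy).contMDiffAt (hopen.mem_nhds hy)).mdifferentiableAt (by simp)
  refine ⟨?_, ?_, ?_, ?_⟩
  · -- smoothness on the translated box
    rw [hbox_eq]
    exact hbox.contMDiffOn.comp hTc.contMDiffOn fun y hy => hy
  · -- open embedding of the translated box
    rw [hbox_eq]
    have hfun : (T ⁻¹' coordBox B τ₁ τ₂ r₁ r₂).restrict (Ψ ∘ T) =
        (coordBox B τ₁ τ₂ r₁ r₂).restrict Ψ ∘ (coordBox B τ₁ τ₂ r₁ r₂).restrictPreimage T := rfl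
    rw [hfun]
    exact hbox.isOpenEmbedding.comp ((coordBox B τ₁ τ₂ r₁ r₂).restrictPreimage_isOpenEmbedding hTe)
  · -- the image is unchanged
    rw [image_comp, hT, image_translateMap_coordBox]
    exact hbox.image_subset
  · -- the `Cᵏ` deviation over the translated box
    refine iSup₂_le fun m hm ↦ iSup₂_le fun y₀ hy₀ ↦ ?_
    obtain ⟨y, hy, rfl⟩ := hy₀
    -- on the open translated box the extended deviation is the translate of that of `Ψ`
    have hev : 𝒮.deviationExtend Bw (Ψ ∘ T) =ᶠ[𝓝 y.1] fun z => 𝒮.deviationExtend B Ψ (z + w) := by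
      refine Filter.eventuallyEq_of_mem (hopenw.mem_nhds ⟨y, hy, rfl⟩) fun z hz ↦ ?_
      obtain ⟨z', hz', rfl⟩ := hz
      have h1 := 𝒮.deviationExtend_coe Bw (Ψ ∘ T) z'
      have h2 := 𝒮.deviationExtend_coe B Ψ (T z')
      exact h1.trans ((deviation_comp_translateMap w z' (hΨd z' hz')).trans h2.symm)
    rw [(hev.iteratedFDeriv ℝ m).eq_of_nhds, iteratedFDeriv_comp_add_right]
    have hTy : T y ∈ coordBox B τ₁ τ₂ r₁ r₂ := by
      rw [hbox_eq] at hy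
      exact hy
    exact (enorm_iteratedFDeriv_le_supCkENorm (S := Subtype.val '' coordBox B τ₁ τ₂ r₁ r₂) hm
      ⟨T y, hTy, rfl⟩ _).trans hbox.supCkENorm_le

end Translate

/-! ### The reductions -/

section Reduction

/-- **K4 WITH A TIME-ORIENTED BOX, from F2ʳ alone (sorry-free).**  The registered signature of
`stub_farCompletion` with the box hypothesis strengthened by `BoxTimeOriented` follows from
`FarHyperboloidalCompletionRest`: take the engine's `(k₁, ε₁, R, T, k', δ, γ)`; given an instance and an
oriented box, the engine returns a translation `w`, a time `s` and a far chart relative to the recentred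
box chart; the recentred background is the star background of `recentre (mo 0) s w`
(`shiftTime_translateBackground_starBackground`), the translated chart is a box of the translated
background (`IsNearModelBox.comp_translateMap`), and the assembly theorem
`isSoundNearKerrLeaf_of_box_of_farChart` yields the sound `(ε, k)`-leaf inside `J⁺(C)`.  This is the
form K4 takes once the orientation of K3's box is threaded through the skeleton.
[cite: DafermosHolzegelRodnianskiTaylor2021, §1] -/
theorem farCompletion_oriented_of_fact (hF : FarHyperboloidalCompletionRest) :
    ∀ (χ m₀ : ℝ) (k : ℕ) (ε : ℝ≥0∞), χ < 1 → 0 < m₀ → 0 < ε →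
    ∃ (k₁ : ℕ) (ε₁ : ℝ≥0∞) (R T : ℝ), 0 < ε₁ ∧ ∃ k' : ℕ, ∀ Λ : ℝ≥0∞, Λ < 1 →
    ∃ (δ : ℝ≥0∞) (γ : ℝ), 0 < δ ∧ 0 < γ ∧
    ∀ (X : Type) [TopologicalSpace X] [ChartedSpace E3 X] [IsManifold (𝓡 3) ∞ X]
      [T2Space X] [SecondCountableTopology X] [ConnectedSpace X],
    ∀ D ∈ admissibleVacuumData X, ∀ (𝒟 : VacuumCauchyDevelopment D)
      (M a : Fin 1 → ℝ) (S : Set 𝒟.carrier) (p : 𝒟.carrier) (mo : Fin 1 → lorentzGroup × E4)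
      (B : Fin 1 → ModelBackground) (Φ : ∀ i, (B i).domain → 𝒟.carrier),
    𝒟.IsMaximal → (∀ i, m₀ ≤ M i ∧ M i ≤ m₀⁻¹ ∧ |a i| ≤ χ * M i) →
    IsPinnedSoundNearKerrLeaf 𝒟.toCauchyDevelopment k' Λ 1 M a S → p ∈ S →
    (∃ i, p ∈ Φ i '' (B i).truncTimeSlab (3 * M i) 0) → (mo 0).1 = 1 →
    𝒟.NearKerrCollarCore k' δ γ 1 M a S p mo B Φ →
    K2Route.CollarFutureOriented 𝒟 M mo B Φ → K2Route.CollarTimeOriented 𝒟 M a mo B Φ →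
    (∃ (τ : ℝ) (Ψ : (B 0).domain → 𝒟.carrier),
      IsNearModelBox 𝒟.toSpacetime (B 0) k₁ ε₁ τ (τ + T) (M 0) (R + 1)
        (𝒟.metric.causalFuture 𝒟.timeOrientation (collarCore M p B Φ)) Ψ ∧
      BoxTimeOriented 𝒟 (M 0) (a 0) (mo 0) (B 0) τ (τ + T) (M 0) (R + 1) Ψ) →
    ∃ S' : Set 𝒟.carrier, 𝒟.toCauchyDevelopment.IsSoundNearKerrLeaf k ε 1 M a S' ∧
      S' ⊆ 𝒟.metric.causalFuture 𝒟.timeOrientation (collarCore M p B Φ) := by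
  intro χ m₀ k ε hχ hm₀ hε
  obtain ⟨k₁, ε₁, R, T, hε₁, hε₁ε, hkk₁, k', hF'⟩ := hF χ m₀ k ε hχ hm₀ hε
  refine ⟨k₁, ε₁, R, T, hε₁, k', fun Λ hΛ => ?_⟩
  obtain ⟨δ, γ, hδ, hγ, H⟩ := hF' Λ hΛ
  refine ⟨δ, γ, hδ, hγ, ?_⟩
  intro X _ _ _ _ _ _ D hD 𝒟 M a S p mo B Φ hmax hwin hleaf hp hpc h1 hcore hfo hto hbox
  obtain ⟨τ, Ψ, hbox, hor⟩ := hbox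
  obtain ⟨w, s, R₁, ρ, U₀, Ψ₀, hs₁, hs₂, hρ, hρR, h2M, hR₁, hfar⟩ :=
    H X D hD 𝒟 M a S p mo B Φ hmax hwin hleaf hp hpc h1 hcore hfo hto τ Ψ hbox hor
  -- labels: `0 < M`, `|a| ≤ χ M ≤ M`
  have hM : 0 < M 0 := hm₀.trans_le (hwin 0).1
  have ha : |a 0| ≤ M 0 := (hwin 0).2.2.trans (by nlinarith [hM])
  -- the collar background, its translate and the recentred background
  have hB : B 0 = starBackground (mo 0).1 (mo 0).2 (M 0) (a 0)
      (fun x => Kerr.radius (a 0) (poincareInv (mo 0).1 (mo 0).2 x)) := hcore.background_eq 0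
  have hBw : translateBackground (B 0) w = starBackground (mo 0).1 ((mo 0).2 - w) (M 0) (a 0)
      (fun x => Kerr.radius (a 0) (poincareInv (mo 0).1 ((mo 0).2 - w) x)) := by
    rw [hB]
    exact translateBackground_starBackground _ _ _ _ w
  have hB' : shiftTime (translateBackground (B 0) w) s =
      starBackground (recentre (mo 0) s w).1 (recentre (mo 0) s w).2 (M 0) (a 0)
        (fun x => Kerr.radius (a 0) (poincareInv (recentre (mo 0) s w).1 (recentre (mo 0) s w).2 x)) := by
    rw [hB]
    exact shiftTime_translateBackground_starBackground (mo 0) (M 0) (a 0) s w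
  -- the translated box and `J⁺(C) ⊆ J⁺(ι X)`
  have hboxw := hbox.comp_translateMap (continuous_time_of_eq_starBackground hB)
    (continuous_radius_of_eq_starBackground hB) w
  have hC := causalFuture_collarCore_subset hleaf.isNearKerrLeaf hp hcore.image_subset
  exact ⟨_, isSoundNearKerrLeaf_of_box_of_farChart 𝒟 hM ha hBw hB' hC hboxw hkk₁ hε₁ε hs₁ hs₂ hρ
    hρR h2M hR₁ hfar⟩

/-- **REDUCTION OF THE REGISTERED K4 TO ITS TYPED INPUTS (sorry-free):**
`stub_farCompletion ⟸ FarHyperboloidalCompletionRest ∧ RestCollarBoxOriented` (binder form; the registered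
one-line form is `stub_farCompletion_of_facts` below).  The registered stub's
box is orientation-blind; the bridge `RestCollarBoxOriented` supplies the orientation below its quality
threshold `ε⋆(χ, m₀, k₁)`, so K4's `ε₁` is the minimum of the engine's `ε₁` and `ε⋆` (a box of the
smaller quality is a box of the engine's quality, `IsNearModelBox.mono`), and
`farCompletion_oriented_of_fact` concludes.  Verbatim the registered signature of `stub_farCompletion`
behind the two inputs. [cite: DafermosHolzegelRodnianskiTaylor2021, §1] -/
theorem farCompletion_of_facts (hF : FarHyperboloidalCompletionRest)
    (hO : RestCollarBoxOriented) :
    ∀ (χ m₀ : ℝ) (k : ℕ) (ε : ℝ≥0∞), χ < 1 → 0 < m₀ → 0 < ε →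
    ∃ (k₁ : ℕ) (ε₁ : ℝ≥0∞) (R T : ℝ), 0 < ε₁ ∧ ∃ k' : ℕ, ∀ Λ : ℝ≥0∞, Λ < 1 →
    ∃ (δ : ℝ≥0∞) (γ : ℝ), 0 < δ ∧ 0 < γ ∧
    ∀ (X : Type) [TopologicalSpace X] [ChartedSpace E3 X] [IsManifold (𝓡 3) ∞ X]
      [T2Space X] [SecondCountableTopology X] [ConnectedSpace X],
    ∀ D ∈ admissibleVacuumData X, ∀ (𝒟 : VacuumCauchyDevelopment D)
      (M a : Fin 1 → ℝ) (S : Set 𝒟.carrier) (p : 𝒟.carrier) (mo : Fin 1 → lorentzGroup × E4)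
      (B : Fin 1 → ModelBackground) (Φ : ∀ i, (B i).domain → 𝒟.carrier),
    𝒟.IsMaximal → (∀ i, m₀ ≤ M i ∧ M i ≤ m₀⁻¹ ∧ |a i| ≤ χ * M i) →
    IsPinnedSoundNearKerrLeaf 𝒟.toCauchyDevelopment k' Λ 1 M a S → p ∈ S →
    (∃ i, p ∈ Φ i '' (B i).truncTimeSlab (3 * M i) 0) → (mo 0).1 = 1 →
    𝒟.NearKerrCollarCore k' δ γ 1 M a S p mo B Φ →
    K2Route.CollarFutureOriented 𝒟 M mo B Φ → K2Route.CollarTimeOriented 𝒟 M a mo B Φ →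
    (∃ (τ : ℝ) (Ψ : (B 0).domain → 𝒟.carrier),
      IsNearModelBox 𝒟.toSpacetime (B 0) k₁ ε₁ τ (τ + T) (M 0) (R + 1)
        (𝒟.metric.causalFuture 𝒟.timeOrientation (collarCore M p B Φ)) Ψ) →
    ∃ S' : Set 𝒟.carrier, 𝒟.toCauchyDevelopment.IsSoundNearKerrLeaf k ε 1 M a S' ∧
      S' ⊆ 𝒟.metric.causalFuture 𝒟.timeOrientation (collarCore M p B Φ) := by
  intro χ m₀ k ε hχ hm₀ hε
  obtain ⟨k₁, ε₁, R, T, hε₁, k', hF'⟩ := farCompletion_oriented_of_fact hF χ m₀ k ε hχ hm₀ hε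
  obtain ⟨ε₀, hε₀, hO'⟩ := hO χ m₀ k₁ hχ hm₀
  refine ⟨k₁, min ε₁ ε₀, R, T, lt_min hε₁ hε₀, k', fun Λ hΛ => ?_⟩
  obtain ⟨δ, γ, hδ, hγ, H⟩ := hF' Λ hΛ
  refine ⟨δ, γ, hδ, hγ, ?_⟩
  intro X _ _ _ _ _ _ D hD 𝒟 M a S p mo B Φ hmax hwin hleaf hp hpc h1 hcore hfo hto hbox
  obtain ⟨τ, Ψ, hbox⟩ := hbox
  have hor : BoxTimeOriented 𝒟 (M 0) (a 0) (mo 0) (B 0) τ (τ + T) (M 0) (R + 1) Ψ :=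
    hO' (min ε₁ ε₀) R T k' Λ δ γ (min_le_right _ _) hΛ X D hD 𝒟 M a S p mo B Φ hmax hwin hleaf hp
      hpc h1 hcore hfo hto τ Ψ hbox
  exact H X D hD 𝒟 M a S p mo B Φ hmax hwin hleaf hp hpc h1 hcore hfo hto
    ⟨τ, Ψ, hbox.mono le_rfl (min_le_left _ _), hor⟩


/-- **Registered sub-goal of the line** (`stub_farCompletion_of_facts`, brick for `stub_farCompletion`): the
registered signature of K4 VERBATIM behind its two typed inputs (one-line closed form of
`farCompletion_of_facts`). [cite: DafermosHolzegelRodnianskiTaylor2021, §1] -/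
theorem stub_farCompletion_of_facts : FarHyperboloidalCompletionRest → RestCollarBoxOriented → ∀ (χ m₀ : ℝ) (k : ℕ) (ε : ℝ≥0∞), χ < 1 → 0 < m₀ → 0 < ε → ∃ (k₁ : ℕ) (ε₁ : ℝ≥0∞) (R T : ℝ), 0 < ε₁ ∧ ∃ k' : ℕ, ∀ Λ : ℝ≥0∞, Λ < 1 → ∃ (δ : ℝ≥0∞) (γ : ℝ), 0 < δ ∧ 0 < γ ∧ ∀ (X : Type) [TopologicalSpace X] [ChartedSpace E3 X] [IsManifold (𝓡 3) ∞ X] [T2Space X] [SecondCountableTopology X] [ConnectedSpace X], ∀ D ∈ admissibleVacuumData X, ∀ (𝒟 : VacuumCauchyDevelopment D) (M a : Fin 1 → ℝ) (S : Set 𝒟.carrier) (p : 𝒟.carrier) (mo : Fin 1 → lorentzGroup × E4) (B : Fin 1 → ModelBackground) (Φ : ∀ i, (B i).domain → 𝒟.carrier), 𝒟.IsMaximal → (∀ i, m₀ ≤ M i ∧ M i ≤ m₀⁻¹ ∧ |a i| ≤ χ * M i) → IsPinnedSoundNearKerrLeaf 𝒟.toCauchyDevelopment k' Λ 1 M a S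 → p ∈ S → (∃ i, p ∈ Φ i '' (B i).truncTimeSlab (3 * M i) 0) → (mo 0).1 = 1 → 𝒟.NearKerrCollarCore k' δ γ 1 M a S p mo B Φ → K2Route.CollarFutureOriented 𝒟 M mo B Φ → K2Route.CollarTimeOriented 𝒟 M a mo B Φ → (∃ (τ : ℝ) (Ψ : (B 0).domain → 𝒟.carrier), IsNearModelBox 𝒟.toSpacetime (B 0) k₁ ε₁ τ (τ + T) (M 0) (R + 1) (𝒟.metric.causalFuture 𝒟.timeOrientation (collarCore M p B Φ)) Ψ) → ∃ S' : Set 𝒟.carrier, 𝒟.toCauchyDevelopment.IsSoundNearKerrLeaf k ε 1 M a S' ∧ S' ⊆ 𝒟.metric.causalFuture 𝒟.timeOrientation (collarCore M p B Φ) :=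
  fun hF hO ↦ farCompletion_of_facts hF hO

end Reduction

end Summit.FinalStateConjecture.FinalStateConjecture.Theorems.BondiBartnikRigidity.DirectMethod

end
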